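/-
Copyright: b2b-lace packet (explicit-unit LEAN TYPING SEAT 1, gen 22; unit `b2b-lace-lean1-g22`).  The Appendix-D oracle
discharge of `NobleOracleDischarge` (stated there for the RECORD family `nobleTriple d`, `Fin 6`) carried to a GENERAL finite
family of weighted diagrams `𝒮 : ι → ℕ × ℕ × Set (Site d)` (`NobleInstantiateFamily`), to the record extended by one
diagram (`nobleTripleSnoc d t`, `Fin 7`), and to the R228 re-cut of the improvement oracle (`NobleImprovementInputsRemFamily`).
Pure logic over landed theorems: d-generic, ι-generic, no numeral, no new definition, no named fact, no dimension sentence.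
-/
import Literature.Probability.FitznerVanDerHofstad2017.NobleOracleDischarge
import Literature.Probability.FitznerVanDerHofstad2017.NobleImprovementInputsRemFamily
import HarnessLib

/-!
# [NoBLE17] Prop. 4.5(ii) → the two oracle binders over a general family `𝒮`, over the one-diagram extension
of the record family, and over the re-cut improvement oracle — App. D in the kernel (module 3c-C′, the family /
re-cut form of `NobleOracleDischarge`)

CITATION HEADER (PLACEMENT v2).  This module is part of a certified REPRODUCTION of: R. Fitzner, R. van der Hofstad,
*Generalized approach to the non-backtracking lace expansion*, Probab. Theory Relat. Fields **169** (2017) 1041–1119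
(= arXiv:1506.07969, "NoBLE17"): §2.1–§2.2 ((2.5)–(2.7): "`𝒮` is some finite set of indices"), Def. 2.9 / Thm 2.10 /
Prop. 2.11 (pp. 1060–1062), Assumption 4.3 and its closing sentence (pp. 1086–1088), Prop. 4.5(ii) (p. 1088), Appendix D
(pp. 1110–1117), §5.3.2 first display (p. 1097: the NBW remainder constants); and R. Fitzner, R. van der Hofstad,
*Mean-field behavior for nearest-neighbor percolation in `d > 10`*, Electron. J. Probab. **22** (2017) no. 43
(= arXiv:1506.07977, "FvdH17"): Prop. 2.1 (NoBLE equations), Prop. 2.2 and (2.21)–(2.23) (the weighted diagrams and the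
record index set), §2.4–§2.5 (the bootstrap run), Thm 1.1 / Cor. 1.3.

CONTEXT.  `NobleOracleDischarge` supplies, for the RECORD family `𝒮 = nobleTriple d` of [FvdH17] (2.23) (six weighted
diagrams, `Fin 6`), the two ORACLE BINDERS of the bootstrap — `NobleInitialInputsAt` at `p_I = 1/(2d−1)` and
`NobleImprovementInputsAt` on `(p_I, p_c)` under `f ≤ Γ` — at the table `nobleBetaOfInputsCorr d i` from Assumption 4.3
of [NoBLE17] plus the weighted-diagram bounds, with App. D PROVED in the kernel (`nobleSimplifiedFormAt_percolation₆`), and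
the end-to-end `meanField_of_certificate_assumption43`.  [NoBLE17] §2.1 leaves the finite index set `𝒮` of `f₃` free;
the tree carries the whole bootstrap over a general finite family (`NobleInstantiateFamily`: `NobleWeightedDiagramBoundOf`,
`NobleInitialInputsOf`, `NobleImprovementInputsOf`, `NobleNumericCertificateOf`, `meanField_of_certificateOf`; the
one-diagram extension `nobleTripleSnoc d t : Fin 7 → …` of the record) and over the R228 RE-CUT of the improvement oracle
(`NobleImprovementInputsRemFamily`: `NobleImprovementInputsRemOf 𝒮 CS cμ c Γ R B b` = the oracle over `𝒮` asked only
under kernel-validity `RemValid d CS R` of a table `R` of NBW-remainder constants at cut-off `CS`;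
`meanField_of_certificateRemOf`).  What was missing is the Assumption-4.3 DISCHARGE of those family / re-cut binders.

THIS MODULE (pure logic; nothing specific to a dimension, an index type, a cut-off or a table):
* §1 constructors of the family diagram binder — `nobleWeightedDiagramBoundOf_of_forall` (pointwise bounds on every
  cell), and for the extension `nobleTripleSnoc d t`: `nobleWeightedDiagramBoundOf_snoc` / `…_snoc_iff` /
  `…_snoc_singleton` (the seven bounds = the record's six, `NobleWeightedDiagramBoundAt`, plus the added cell) and
  `nobleF_le_of_nobleFOf_snoc_le` (the extension's bootstrap hypothesis `f^{𝒮'} ≤ Γ` implies the record's `f ≤ Γ`).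
* §2 the binders from Assumption 4.3, App. D in the kernel: `nobleImprovementInputsOf_of_assumption43`,
  `nobleInitialInputsOf_of_assumption43` (word for word the record theorems with `nobleTriple d ↦ 𝒮`: the simplified-form
  half is `nobleSimplifiedFormAt_percolation₆`, independent of `𝒮`; the diagram half is carried), the re-cut forms
  `nobleImprovementInputsRemOf_of_assumption43` / `nobleImprovementInputsRemAt_of_assumption43` (inputs asked under
  `RemValid d CS R`), and the `Fin 7` readings `…_snoc_of_assumption43` in which the RECORD-SHAPED providers (Assumption 4.3
  and the six record cells under the record's `f ≤ Γ`) are reused as they stand and only the seventh cell is new.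
* §3 mean-field behaviour (`d ≥ 7`; triangle condition, `θ(p_c) = 0`, `β = 1` — [FvdH17] Cor. 1.3 in full then follows by
  the tree's `meanField_of_triangle`): `meanField_of_certificateOf_assumption43`, `meanField_of_certificateRemOf_assumption43`,
  the record re-cut `meanField_of_certificateRem_assumption43`, and the `Fin 7` re-cut reading
  `meanField_of_certificateRemOf_snoc_assumption43`.
* COHERENCE: at `𝒮 = nobleTriple d` the theorems of §2–§3 ARE the record theorems of `NobleOracleDischarge`
  (`nobleWeightedDiagramBoundOf_nobleTriple_iff`, `nobleInitialInputsOf_nobleTriple_iff`,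
  `nobleImprovementInputsOf_nobleTriple_iff`, `nobleImprovementInputsRemOf_nobleTriple_iff` are `Iff.rfl`;
  `nobleFOf_nobleTriple` is `rfl`).

HONEST LABEL (ABSOLUTE RULE; REFEREE V1(b)).  Nothing is cited as a fact and no hypothesis is hidden.  What REMAINS on any
line through this module is typed and visible in the binders: (S2a) Assumption 4.3 of [NoBLE17] at the percolation split
with the constants of a record `i` ([FvdH17] §§4–6, the `x`-space diagrammatic bounds: ANALYTIC, not proved here);
(S2b) the weighted-diagram bounds over `𝒮` ([FvdH17] Prop. 2.2 / [NoBLE17] (3.87)); the numeric certificate over `𝒮`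
(arithmetic at a table) and the decidable sign conditions (N1′)–(N4) of the records; for the re-cut, `RemValid d CS R`
(a kernel obligation at a literal table: `remValid_remPrint`, `remValid_remKsup`, or a certified column).  The binders over
a family other than `nobleTriple d`, and every re-cut binder, are the programme's readings (R228: "kernel modulo the re-cut
oracle at the tuple") — NOT the oracle of record and NOT CITABLE once tables are numerals; no family, cut-off, table or
dimension is instantiated here, and no dimension sentence follows from this file.  `NobleOracleDischarge`,
`NobleInstantiate(Family)`, `NobleImprovementInputsRem(Family)`, the generated `BetaMap` and every certificate module are
untouched.
-/

noncomputable section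

namespace Literature.Probability.FitznerVanDerHofstad2017

open _root_.MeasureTheory _root_.Filter _root_.Topology Literature.Probability.LatticeModels
open Literature.Barriers.CriticalPhenomena Literature.Probability.Percolation
open scoped BigOperators

variable {d : ℕ} {ι : Type*}

/-! ## 1. Constructors of the family diagram binder -/

/-- Pointwise bounds on every cell give the family diagram binder: if `0 ≤ b_k` and `ℋ^{n_k,l_k}_p(x) ≤ b_k` for all
`x ∈ S_k`, then `sup_{x ∈ S_k} ℋ^{n_k,l_k}_p(x) ≤ b_k` for every `k` (each `sup` is a real `iSup`, `0` on `∅`).  The record's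
`nobleWeightedDiagramBoundAt_of_forall` is the case `𝒮 = nobleTriple d`.
[cite: FitznerVanDerHofstad2016NoBLE, (2.7) and §3.3.5 (3.87) p. 1079] [cite: FitznerVanDerHofstad2017, Prop. 2.2 and (2.21)–(2.23)] -/
theorem nobleWeightedDiagramBoundOf_of_forall {𝒮 : ι → ℕ × ℕ × Set (Site d)} {p : unitInterval} {b : ι → ℝ}
    (hb : ∀ k, 0 ≤ b k) (h : ∀ k, ∀ x ∈ (𝒮 k).2.2, nobleH d (𝒮 k).1 (𝒮 k).2.1 p x ≤ b k) :
    NobleWeightedDiagramBoundOf 𝒮 p b := fun k => by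
  rw [nobleSupH]
  exact Real.iSup_le (fun x => h k x.1 x.2) (hb k)

/-- The diagram binder over the one-diagram extension `(nobleTriple d, t)` of the record family from its two parts: the
record's six bounds ([FvdH17] (2.23)) and a bound on the added diagram `t = (n, l, S)`.
[cite: FitznerVanDerHofstad2016NoBLE, (2.7) and §2.1 ("𝒮 is some finite set of indices")] [cite: FitznerVanDerHofstad2017, (2.23)] -/
theorem nobleWeightedDiagramBoundOf_snoc {t : ℕ × ℕ × Set (Site d)} {p : unitInterval} {b : Fin 7 → ℝ}
    (h₆ : NobleWeightedDiagramBoundAt d p (b ∘ Fin.castSucc)) (ht : nobleSupH d t.1 t.2.1 t.2.2 p ≤ b (Fin.last 6)) :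
    NobleWeightedDiagramBoundOf (nobleTripleSnoc d t) p b := fun k => by
  induction k using Fin.lastCases with
  | last => rwa [nobleTripleSnoc_last]
  | cast k => rw [nobleTripleSnoc_castSucc]; exact h₆ k

/-- The diagram binder over the extension `(nobleTriple d, t)` IS the record's binder on the six diagrams of [FvdH17] (2.23)
together with the bound on the added one. [cite: FitznerVanDerHofstad2016NoBLE, (2.7) and §2.1] [cite: FitznerVanDerHofstad2017, (2.23)] -/
theorem nobleWeightedDiagramBoundOf_snoc_iff {t : ℕ × ℕ × Set (Site d)} {p : unitInterval} {b : Fin 7 → ℝ} :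
    NobleWeightedDiagramBoundOf (nobleTripleSnoc d t) p b ↔
      NobleWeightedDiagramBoundAt d p (b ∘ Fin.castSucc) ∧ nobleSupH d t.1 t.2.1 t.2.2 p ≤ b (Fin.last 6) :=
  ⟨fun h => ⟨h.toAt_of_snoc, h.last_of_snoc⟩, fun h => nobleWeightedDiagramBoundOf_snoc h.1 h.2⟩

/-- Singleton-carried added diagram `t = (n, l, {x₀})` ([NoBLE17] §5.3.3: "`S = {0}`"): the record's six bounds and
`ℋ^{n,l}_p(x₀) ≤ b₆` give the binder over the extension.
[cite: FitznerVanDerHofstad2016NoBLE, (2.7) and §5.3.3 ("S = {0}")] [cite: FitznerVanDerHofstad2017, (2.23)] -/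
theorem nobleWeightedDiagramBoundOf_snoc_singleton {n l : ℕ} {x₀ : Site d} {p : unitInterval} {b : Fin 7 → ℝ}
    (h₆ : NobleWeightedDiagramBoundAt d p (b ∘ Fin.castSucc)) (ht : nobleH d n l p x₀ ≤ b (Fin.last 6)) :
    NobleWeightedDiagramBoundOf (nobleTripleSnoc d (n, l, ({x₀} : Set (Site d)))) p b :=
  nobleWeightedDiagramBoundOf_snoc h₆ (by rw [nobleSupH, ciSup_unique]; exact ht)

/-- The bootstrap hypothesis over the extension implies the record's: `f₁`, `f₂` do not depend on the family, and the
record's `f₃` (restricted constants) is at most the extension's (`nobleF3_le_nobleF3Of_snoc`).  So every provider stated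
under the RECORD's hypothesis `f ≤ Γ` applies under the extension's.
[cite: FitznerVanDerHofstad2016NoBLE, (2.5)–(2.7) and §3.3 (proof of Prop. 3.6: bounds "computed under the assumption f_i(z) ≤ Γ_i")] -/
theorem nobleF_le_of_nobleFOf_snoc_le (t : ℕ × ℕ × Set (Site d)) {cμ : ℝ} {c : Fin 7 → ℝ} {Γ : Fin 3 → ℝ}
    {p : unitInterval} (hΓ : ∀ j, nobleFOf (nobleTripleSnoc d t) cμ c j p ≤ Γ j) (j : Fin 3) :
    Literature.Barriers.CriticalPhenomena.nobleF d cμ (c ∘ Fin.castSucc) j p ≤ Γ j := by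
  fin_cases j
  · exact hΓ 0
  · exact hΓ 1
  · exact (nobleF3_le_nobleF3Of_snoc t c p).trans (hΓ 2)

/-! ## 2. The oracle binders over `𝒮` from Assumption 4.3, App. D in the kernel -/

/-- **The initial-step binder over a general family `𝒮`, WITHOUT the Prop. 4.5(ii) hypothesis**
(`nobleInitialInputsAt_of_assumption43` with `nobleTriple d ↦ 𝒮`): at `p_I = 1/(2d−1)`, Assumption 4.3 for the percolation
split with the initial-stage constants `i` ([NoBLE17] Assumption 4.3, closing sentence) and the weighted-diagram bounds `bi`
over `𝒮` at `p_I` give `NobleInitialInputsOf 𝒮 (β^corr(i)) bi`, for a well-formed `i` satisfying (N1′)–(N4).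
[cite: FitznerVanDerHofstad2016NoBLE, Prop. 4.5(ii) (p. 1088); Assumption 4.3, closing sentence (p. 1088); Prop. 2.11 (p. 1061); §3.3.3]
[cite: FitznerVanDerHofstad2017, Prop. 2.2 (EJP p. 11); §2.4–§2.5 (the checks at p_I = 1/(2d−1))] -/
theorem nobleInitialInputsOf_of_assumption43 (hd : 2 ≤ d) {𝒮 : ι → ℕ × ℕ × Set (Site d)} {i : BetaMap.Inputs}
    {bi : ι → ℝ} (hWF : NobleInputsWF d i)
    (hN1 : 0 ≤ BetaMap.betaCPhiLow d i.mu i.xiAlphaOneMinusZeroAtZero i.xiIotaAlphaIAtEi)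
    (hN2 : i.xiAbs + i.xiIotaAbs < 1) (hN3 : (BetaMap.nobleBetaOfInputs d i).βΨ < 1)
    (hN4 : 0 ≤ (BetaMap.nobleBetaOfInputs d i).αFlow)
    (h43 : NobleAssumption43At d (nbwThresholdI d)
      (percolationNobleSplit d (nbwThresholdI d) hd (nbwThresholdI_lt_criticalProbI hd)) i)
    (hW : NobleWeightedDiagramBoundOf 𝒮 (nbwThresholdI d) bi) :
    NobleInitialInputsOf 𝒮 (BetaMap.nobleBetaOfInputsCorr d i) bi :=
  ⟨nobleSimplifiedFormAt_percolation₆ hd (nbwThresholdI_lt_criticalProbI hd) (nbwThresholdI_pos (by omega)) hWF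
    h43 hN1 hN2 hN3 hN4, hW⟩

section Family

variable [Fintype ι] [Nonempty ι]

/-- **The improvement-step binder over a general family `𝒮`, WITHOUT the Prop. 4.5(ii) hypothesis**
(`nobleImprovementInputsAt_of_assumption43` with `nobleTriple d ↦ 𝒮`).  For `d ≥ 2`, a well-formed record `i` satisfying
(N1′)–(N4), and — at every `p ∈ (p_I, p_c)` at which `f^{𝒮}_j(p) ≤ Γ_j` — Assumption 4.3 for the percolation split with
constants `i` together with the weighted-diagram bounds `b` over `𝒮`: `NobleImprovementInputsOf 𝒮 cμ c Γ (β^corr(i)) b`.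
The simplified NoBLE form at `p` is the kernel theorem `nobleSimplifiedFormAt_percolation₆` (App. D, NoBLE equations
discharged), independent of `𝒮`.
[cite: FitznerVanDerHofstad2016NoBLE, Prop. 4.5(ii) (p. 1088); Assumption 4.3 (pp. 1086–1088); (2.7) and §2.1; App. D (pp. 1110–1117)]
[cite: FitznerVanDerHofstad2017, Prop. 2.1, Prop. 2.2 (EJP pp. 10–11); §2.4–§2.5] -/
theorem nobleImprovementInputsOf_of_assumption43 (hd : 2 ≤ d) {𝒮 : ι → ℕ × ℕ × Set (Site d)} {cμ : ℝ}
    {c : ι → ℝ} {Γ : Fin 3 → ℝ} {i : BetaMap.Inputs} {b : ι → ℝ} (hWF : NobleInputsWF d i)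
    (hN1 : 0 ≤ BetaMap.betaCPhiLow d i.mu i.xiAlphaOneMinusZeroAtZero i.xiIotaAlphaIAtEi)
    (hN2 : i.xiAbs + i.xiIotaAbs < 1) (hN3 : (BetaMap.nobleBetaOfInputs d i).βΨ < 1)
    (hN4 : 0 ≤ (BetaMap.nobleBetaOfInputs d i).αFlow)
    (hS : ∀ (p : unitInterval) (hp : p ∈ Set.Ioo (nbwThresholdI d) (criticalProbI d)),
      (∀ j, nobleFOf 𝒮 cμ c j p ≤ Γ j) →
        NobleAssumption43At d p (percolationNobleSplit d p hd hp.2) i ∧ NobleWeightedDiagramBoundOf 𝒮 p b) :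
    NobleImprovementInputsOf 𝒮 cμ c Γ (BetaMap.nobleBetaOfInputsCorr d i) b := by
  intro p hp hΓ
  obtain ⟨h43, hW⟩ := hS p hp hΓ
  have hp0 : 0 < (p : ℝ) :=
    lt_trans (nbwThresholdI_pos (by omega)) (show (nbwThresholdI d : ℝ) < p by exact_mod_cast hp.1)
  exact ⟨nobleSimplifiedFormAt_percolation₆ hd hp.2 hp0 hWF h43 hN1 hN2 hN3 hN4, hW⟩

/-- **The RE-CUT improvement binder over `𝒮` from Assumption 4.3** (R228): the Assumption-4.3 / diagram inputs are asked
only under kernel-validity `RemValid d CS R` of the table `R` of NBW-remainder constants at cut-off `CS` ([NoBLE17] §5.3.2,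
first display), which the provider may use; conclusion `NobleImprovementInputsRemOf 𝒮 CS cμ c Γ R (β^corr(i)) b`.
[cite: FitznerVanDerHofstad2016NoBLE, Prop. 4.5(ii) (p. 1088); Assumption 4.3 (pp. 1086–1088); §5.3.2 (first display) p. 1097]
[cite: FitznerVanDerHofstad2017, §4.2 (4.18); Prop. 2.2, §2.3–§2.4] -/
theorem nobleImprovementInputsRemOf_of_assumption43 (hd : 2 ≤ d) {𝒮 : ι → ℕ × ℕ × Set (Site d)} {CS : ℕ}
    {cμ : ℝ} {c : ι → ℝ} {Γ : Fin 3 → ℝ} {R : RemRead → ℝ} {i : BetaMap.Inputs} {b : ι → ℝ}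
    (hWF : NobleInputsWF d i)
    (hN1 : 0 ≤ BetaMap.betaCPhiLow d i.mu i.xiAlphaOneMinusZeroAtZero i.xiIotaAlphaIAtEi)
    (hN2 : i.xiAbs + i.xiIotaAbs < 1) (hN3 : (BetaMap.nobleBetaOfInputs d i).βΨ < 1)
    (hN4 : 0 ≤ (BetaMap.nobleBetaOfInputs d i).αFlow)
    (hS : RemValid d CS R → ∀ (p : unitInterval) (hp : p ∈ Set.Ioo (nbwThresholdI d) (criticalProbI d)),
      (∀ j, nobleFOf 𝒮 cμ c j p ≤ Γ j) →
        NobleAssumption43At d p (percolationNobleSplit d p hd hp.2) i ∧ NobleWeightedDiagramBoundOf 𝒮 p b) :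
    NobleImprovementInputsRemOf 𝒮 CS cμ c Γ R (BetaMap.nobleBetaOfInputsCorr d i) b :=
  fun hR => nobleImprovementInputsOf_of_assumption43 hd hWF hN1 hN2 hN3 hN4 (hS hR)

end Family

/-- **The RE-CUT improvement binder OF THE RECORD from Assumption 4.3** (`NobleImprovementInputsRemAt`, record family and
the record's `f ≤ Γ`; the `𝒮 = nobleTriple d` instance of `nobleImprovementInputsRemOf_of_assumption43`, by `Iff.rfl`).
[cite: FitznerVanDerHofstad2016NoBLE, Prop. 4.5(ii) (p. 1088); Assumption 4.3 (pp. 1086–1088); §5.3.2 (first display) p. 1097]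
[cite: FitznerVanDerHofstad2017, §4.2 (4.18); Prop. 2.2, (2.23), §2.3–§2.4] -/
theorem nobleImprovementInputsRemAt_of_assumption43 (hd : 2 ≤ d) {CS : ℕ} {cμ : ℝ} {c : Fin 6 → ℝ}
    {Γ : Fin 3 → ℝ} {R : RemRead → ℝ} {i : BetaMap.Inputs} {b : Fin 6 → ℝ} (hWF : NobleInputsWF d i)
    (hN1 : 0 ≤ BetaMap.betaCPhiLow d i.mu i.xiAlphaOneMinusZeroAtZero i.xiIotaAlphaIAtEi)
    (hN2 : i.xiAbs + i.xiIotaAbs < 1) (hN3 : (BetaMap.nobleBetaOfInputs d i).βΨ < 1)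
    (hN4 : 0 ≤ (BetaMap.nobleBetaOfInputs d i).αFlow)
    (hS : RemValid d CS R → ∀ (p : unitInterval) (hp : p ∈ Set.Ioo (nbwThresholdI d) (criticalProbI d)),
      (∀ j, Literature.Barriers.CriticalPhenomena.nobleF d cμ c j p ≤ Γ j) →
        NobleAssumption43At d p (percolationNobleSplit d p hd hp.2) i ∧ NobleWeightedDiagramBoundAt d p b) :
    NobleImprovementInputsRemAt d CS cμ c Γ R (BetaMap.nobleBetaOfInputsCorr d i) b :=
  fun hR => nobleImprovementInputsAt_of_assumption43 hd hWF hN1 hN2 hN3 hN4 (hS hR)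

/-! ### The `Fin 7` readings: the record family extended by one weighted diagram -/

/-- **Improvement-step binder over the extension `(nobleTriple d, t)`, record-shaped providers reused.**  The inputs are
split as in a discharge of the record: `hS₆` = Assumption 4.3 with constants `i` AND the six record cells `b ∘ castSucc`
([FvdH17] (2.23)), both under the RECORD's bootstrap hypothesis `f ≤ Γ` (restricted constants `c ∘ castSucc`) — i.e.
exactly the `hS` of `nobleImprovementInputsAt_of_assumption43`; `hS₇` = the added cell `sup_{x ∈ S} ℋ^{n,l}_p(x) ≤ b₆`
under the extension's hypothesis.  Conclusion: `NobleImprovementInputsOf (nobleTripleSnoc d t) cμ c Γ (β^corr(i)) b`.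
[cite: FitznerVanDerHofstad2016NoBLE, Prop. 4.5(ii) (p. 1088); (2.7) and §2.1; §5.3.3 (the carried diagram)]
[cite: FitznerVanDerHofstad2017, Prop. 2.2 and (2.21)–(2.23); §2.5] -/
theorem nobleImprovementInputsOf_snoc_of_assumption43 (hd : 2 ≤ d) {t : ℕ × ℕ × Set (Site d)} {cμ : ℝ}
    {c : Fin 7 → ℝ} {Γ : Fin 3 → ℝ} {i : BetaMap.Inputs} {b : Fin 7 → ℝ} (hWF : NobleInputsWF d i)
    (hN1 : 0 ≤ BetaMap.betaCPhiLow d i.mu i.xiAlphaOneMinusZeroAtZero i.xiIotaAlphaIAtEi)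
    (hN2 : i.xiAbs + i.xiIotaAbs < 1) (hN3 : (BetaMap.nobleBetaOfInputs d i).βΨ < 1)
    (hN4 : 0 ≤ (BetaMap.nobleBetaOfInputs d i).αFlow)
    (hS₆ : ∀ (p : unitInterval) (hp : p ∈ Set.Ioo (nbwThresholdI d) (criticalProbI d)),
      (∀ j, Literature.Barriers.CriticalPhenomena.nobleF d cμ (c ∘ Fin.castSucc) j p ≤ Γ j) →
        NobleAssumption43At d p (percolationNobleSplit d p hd hp.2) i ∧
          NobleWeightedDiagramBoundAt d p (b ∘ Fin.castSucc))
    (hS₇ : ∀ (p : unitInterval) (_hp : p ∈ Set.Ioo (nbwThresholdI d) (criticalProbI d)),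
      (∀ j, nobleFOf (nobleTripleSnoc d t) cμ c j p ≤ Γ j) → nobleSupH d t.1 t.2.1 t.2.2 p ≤ b (Fin.last 6)) :
    NobleImprovementInputsOf (nobleTripleSnoc d t) cμ c Γ (BetaMap.nobleBetaOfInputsCorr d i) b :=
  nobleImprovementInputsOf_of_assumption43 hd hWF hN1 hN2 hN3 hN4 fun p hp hΓ =>
    ⟨(hS₆ p hp (nobleF_le_of_nobleFOf_snoc_le t hΓ)).1,
      nobleWeightedDiagramBoundOf_snoc (hS₆ p hp (nobleF_le_of_nobleFOf_snoc_le t hΓ)).2 (hS₇ p hp hΓ)⟩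

/-- **Initial-step binder over the extension `(nobleTriple d, t)`**: Assumption 4.3 at `p_I` with the initial-stage constants
`i`, the six record cells `bi ∘ castSucc` at `p_I` ([NoBLE17] §3.3.3) and the added cell at `p_I`.
[cite: FitznerVanDerHofstad2016NoBLE, Prop. 4.5(ii) (p. 1088); Assumption 4.3, closing sentence (p. 1088); §3.3.3; (2.7) and §2.1]
[cite: FitznerVanDerHofstad2017, Prop. 2.2 and (2.23); §2.4–§2.5] -/
theorem nobleInitialInputsOf_snoc_of_assumption43 (hd : 2 ≤ d) {t : ℕ × ℕ × Set (Site d)} {i : BetaMap.Inputs}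
    {bi : Fin 7 → ℝ} (hWF : NobleInputsWF d i)
    (hN1 : 0 ≤ BetaMap.betaCPhiLow d i.mu i.xiAlphaOneMinusZeroAtZero i.xiIotaAlphaIAtEi)
    (hN2 : i.xiAbs + i.xiIotaAbs < 1) (hN3 : (BetaMap.nobleBetaOfInputs d i).βΨ < 1)
    (hN4 : 0 ≤ (BetaMap.nobleBetaOfInputs d i).αFlow)
    (h43 : NobleAssumption43At d (nbwThresholdI d)
      (percolationNobleSplit d (nbwThresholdI d) hd (nbwThresholdI_lt_criticalProbI hd)) i)
    (hW₆ : NobleWeightedDiagramBoundAt d (nbwThresholdI d) (bi ∘ Fin.castSucc))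
    (hW₇ : nobleSupH d t.1 t.2.1 t.2.2 (nbwThresholdI d) ≤ bi (Fin.last 6)) :
    NobleInitialInputsOf (nobleTripleSnoc d t) (BetaMap.nobleBetaOfInputsCorr d i) bi :=
  nobleInitialInputsOf_of_assumption43 hd hWF hN1 hN2 hN3 hN4 h43 (nobleWeightedDiagramBoundOf_snoc hW₆ hW₇)

/-- **Re-cut improvement binder over the extension `(nobleTriple d, t)`**: as `nobleImprovementInputsOf_snoc_of_assumption43`
with both providers asked under `RemValid d CS R` ([NoBLE17] §5.3.2, first display).
[cite: FitznerVanDerHofstad2016NoBLE, Prop. 4.5(ii) (p. 1088); §5.3.2 (first display) p. 1097; (2.7) and §2.1; §5.3.3]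
[cite: FitznerVanDerHofstad2017, §4.2 (4.18); Prop. 2.2 and (2.23)] -/
theorem nobleImprovementInputsRemOf_snoc_of_assumption43 (hd : 2 ≤ d) {t : ℕ × ℕ × Set (Site d)} {CS : ℕ}
    {cμ : ℝ} {c : Fin 7 → ℝ} {Γ : Fin 3 → ℝ} {R : RemRead → ℝ} {i : BetaMap.Inputs} {b : Fin 7 → ℝ}
    (hWF : NobleInputsWF d i)
    (hN1 : 0 ≤ BetaMap.betaCPhiLow d i.mu i.xiAlphaOneMinusZeroAtZero i.xiIotaAlphaIAtEi)
    (hN2 : i.xiAbs + i.xiIotaAbs < 1) (hN3 : (BetaMap.nobleBetaOfInputs d i).βΨ < 1)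
    (hN4 : 0 ≤ (BetaMap.nobleBetaOfInputs d i).αFlow)
    (hS₆ : RemValid d CS R → ∀ (p : unitInterval) (hp : p ∈ Set.Ioo (nbwThresholdI d) (criticalProbI d)),
      (∀ j, Literature.Barriers.CriticalPhenomena.nobleF d cμ (c ∘ Fin.castSucc) j p ≤ Γ j) →
        NobleAssumption43At d p (percolationNobleSplit d p hd hp.2) i ∧
          NobleWeightedDiagramBoundAt d p (b ∘ Fin.castSucc))
    (hS₇ : RemValid d CS R → ∀ (p : unitInterval) (_hp : p ∈ Set.Ioo (nbwThresholdI d) (criticalProbI d)),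
      (∀ j, nobleFOf (nobleTripleSnoc d t) cμ c j p ≤ Γ j) → nobleSupH d t.1 t.2.1 t.2.2 p ≤ b (Fin.last 6)) :
    NobleImprovementInputsRemOf (nobleTripleSnoc d t) CS cμ c Γ R (BetaMap.nobleBetaOfInputsCorr d i) b :=
  fun hR => nobleImprovementInputsOf_snoc_of_assumption43 hd hWF hN1 hN2 hN3 hN4 (hS₆ hR) (hS₇ hR)

/-! ## 3. Mean-field behaviour from a certificate over `𝒮`, no Prop. 4.5(ii) leaf -/

section Family

variable [Fintype ι] [Nonempty ι]

/-- **Mean-field behaviour at dimension `d ≥ 7` from a certified NoBLE bootstrap over a general `𝒮`, App. D in the kernel**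
(`meanField_of_certificateOf` with both binders supplied by §2; `meanField_of_certificate_assumption43` with
`nobleTriple d ↦ 𝒮`).  Hypotheses, all typed and visible: a numeric certificate `P(γ, Γ)` over `𝒮` for the tables
`β^corr(iI)`, `β^corr(iO)` and the bounds `bi`, `bo`; well-formed records `iI`, `iO` with (N1′)–(N4); Assumption 4.3 with
constants `iI` at `p_I` and the diagram bounds `bi` over `𝒮` there; at every `p ∈ (p_I, p_c)` with `f^{𝒮}(p) ≤ Γ`,
Assumption 4.3 with constants `iO` and the bounds `bo` over `𝒮`.  Conclusion: triangle condition, `θ(p_c) = 0`, `β = 1`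
(bounded ratio) in dimension `d`.
[cite: FitznerVanDerHofstad2016NoBLE, Thm 2.10, Prop. 2.11, Def. 2.9 (pp. 1060–1062); (2.7) and §2.1; Prop. 4.5(ii) (p. 1088); App. D (pp. 1110–1117)]
[cite: FitznerVanDerHofstad2017, Thm 1.1 and Cor. 1.3; Prop. 2.1, Prop. 2.2 (EJP pp. 10–11)] -/
theorem meanField_of_certificateOf_assumption43 (hd : 7 ≤ d) {𝒮 : ι → ℕ × ℕ × Set (Site d)}
    {cμ : ℝ} {c : ι → ℝ} {γ Γ : Fin 3 → ℝ} {iI iO : BetaMap.Inputs} {bi bo : ι → ℝ}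
    (hN : NobleNumericCertificateOf d cμ c γ Γ (BetaMap.nobleBetaOfInputsCorr d iI)
      (BetaMap.nobleBetaOfInputsCorr d iO) bi bo)
    (hWFI : NobleInputsWF d iI)
    (hI1 : 0 ≤ BetaMap.betaCPhiLow d iI.mu iI.xiAlphaOneMinusZeroAtZero iI.xiIotaAlphaIAtEi)
    (hI2 : iI.xiAbs + iI.xiIotaAbs < 1) (hI3 : (BetaMap.nobleBetaOfInputs d iI).βΨ < 1)
    (hI4 : 0 ≤ (BetaMap.nobleBetaOfInputs d iI).αFlow)
    (hWFO : NobleInputsWF d iO)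
    (hO1 : 0 ≤ BetaMap.betaCPhiLow d iO.mu iO.xiAlphaOneMinusZeroAtZero iO.xiIotaAlphaIAtEi)
    (hO2 : iO.xiAbs + iO.xiIotaAbs < 1) (hO3 : (BetaMap.nobleBetaOfInputs d iO).βΨ < 1)
    (hO4 : 0 ≤ (BetaMap.nobleBetaOfInputs d iO).αFlow)
    (hI43 : NobleAssumption43At d (nbwThresholdI d)
      (percolationNobleSplit d (nbwThresholdI d) (by omega) (nbwThresholdI_lt_criticalProbI (by omega))) iI)
    (hIW : NobleWeightedDiagramBoundOf 𝒮 (nbwThresholdI d) bi)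
    (hS : ∀ (p : unitInterval) (hp : p ∈ Set.Ioo (nbwThresholdI d) (criticalProbI d)),
      (∀ j, nobleFOf 𝒮 cμ c j p ≤ Γ j) →
        NobleAssumption43At d p (percolationNobleSplit d p (by omega) hp.2) iO ∧ NobleWeightedDiagramBoundOf 𝒮 p bo) :
    TriangleCondition d ∧ PercolationContinuity d ∧ BetaEqOneBoundedRatio d :=
  meanField_of_certificateOf hd hN
    (nobleInitialInputsOf_of_assumption43 (by omega) hWFI hI1 hI2 hI3 hI4 hI43 hIW)
    (nobleImprovementInputsOf_of_assumption43 (by omega) hWFO hO1 hO2 hO3 hO4 hS)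

/-- **Mean-field behaviour at `d ≥ 7` from a certified bootstrap over `𝒮` with the improvement oracle RE-CUT, App. D in the
kernel** (`meanField_of_certificateRemOf` with both binders supplied by §2): as `meanField_of_certificateOf_assumption43`,
except that the improvement-stage inputs are asked only under `RemValid d CS R`, and `RemValid d CS R` itself is a displayed
hypothesis (a kernel obligation at a literal table).
[cite: FitznerVanDerHofstad2016NoBLE, Thm 2.10, Prop. 2.11, Def. 2.9 (pp. 1060–1062); §5.3.2 (first display) p. 1097; Prop. 4.5(ii); App. D]
[cite: FitznerVanDerHofstad2017, Thm 1.1 and Cor. 1.3; §4.2 (4.18); Prop. 2.1, Prop. 2.2] -/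
theorem meanField_of_certificateRemOf_assumption43 (hd : 7 ≤ d) {𝒮 : ι → ℕ × ℕ × Set (Site d)} {CS : ℕ}
    {cμ : ℝ} {c : ι → ℝ} {γ Γ : Fin 3 → ℝ} {R : RemRead → ℝ} {iI iO : BetaMap.Inputs} {bi bo : ι → ℝ}
    (hN : NobleNumericCertificateOf d cμ c γ Γ (BetaMap.nobleBetaOfInputsCorr d iI)
      (BetaMap.nobleBetaOfInputsCorr d iO) bi bo)
    (hWFI : NobleInputsWF d iI)
    (hI1 : 0 ≤ BetaMap.betaCPhiLow d iI.mu iI.xiAlphaOneMinusZeroAtZero iI.xiIotaAlphaIAtEi)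
    (hI2 : iI.xiAbs + iI.xiIotaAbs < 1) (hI3 : (BetaMap.nobleBetaOfInputs d iI).βΨ < 1)
    (hI4 : 0 ≤ (BetaMap.nobleBetaOfInputs d iI).αFlow)
    (hWFO : NobleInputsWF d iO)
    (hO1 : 0 ≤ BetaMap.betaCPhiLow d iO.mu iO.xiAlphaOneMinusZeroAtZero iO.xiIotaAlphaIAtEi)
    (hO2 : iO.xiAbs + iO.xiIotaAbs < 1) (hO3 : (BetaMap.nobleBetaOfInputs d iO).βΨ < 1)
    (hO4 : 0 ≤ (BetaMap.nobleBetaOfInputs d iO).αFlow)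
    (hI43 : NobleAssumption43At d (nbwThresholdI d)
      (percolationNobleSplit d (nbwThresholdI d) (by omega) (nbwThresholdI_lt_criticalProbI (by omega))) iI)
    (hIW : NobleWeightedDiagramBoundOf 𝒮 (nbwThresholdI d) bi) (hR : RemValid d CS R)
    (hS : RemValid d CS R → ∀ (p : unitInterval) (hp : p ∈ Set.Ioo (nbwThresholdI d) (criticalProbI d)),
      (∀ j, nobleFOf 𝒮 cμ c j p ≤ Γ j) →
        NobleAssumption43At d p (percolationNobleSplit d p (by omega) hp.2) iO ∧ NobleWeightedDiagramBoundOf 𝒮 p bo) :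
    TriangleCondition d ∧ PercolationContinuity d ∧ BetaEqOneBoundedRatio d :=
  meanField_of_certificateRemOf hd hN
    (nobleInitialInputsOf_of_assumption43 (by omega) hWFI hI1 hI2 hI3 hI4 hI43 hIW) hR
    (nobleImprovementInputsRemOf_of_assumption43 (by omega) hWFO hO1 hO2 hO3 hO4 hS)

end Family

/-- **Mean-field behaviour at `d ≥ 7`, RECORD family, improvement oracle re-cut, App. D in the kernel**
(`meanField_of_certificateRem` with both binders from Assumption 4.3: the `𝒮 = nobleTriple d` instance of
`meanField_of_certificateRemOf_assumption43`).  Remaining hypotheses as in `meanField_of_certificate_assumption43` plus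
`RemValid d CS R`, under which the improvement-stage inputs are asked.
[cite: FitznerVanDerHofstad2016NoBLE, Thm 2.10, Prop. 2.11, Def. 2.9 (pp. 1060–1062); §5.3.2 (first display) p. 1097; Prop. 4.5(ii); App. D]
[cite: FitznerVanDerHofstad2017, Thm 1.1 and Cor. 1.3; §4.2 (4.18); Prop. 2.1, Prop. 2.2, (2.23)] -/
theorem meanField_of_certificateRem_assumption43 (hd : 7 ≤ d) {CS : ℕ} {cμ : ℝ} {c : Fin 6 → ℝ} {γ Γ : Fin 3 → ℝ}
    {R : RemRead → ℝ} {iI iO : BetaMap.Inputs} {bi bo : Fin 6 → ℝ}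
    (hN : NobleNumericCertificate d cμ c γ Γ (BetaMap.nobleBetaOfInputsCorr d iI)
      (BetaMap.nobleBetaOfInputsCorr d iO) bi bo)
    (hWFI : NobleInputsWF d iI)
    (hI1 : 0 ≤ BetaMap.betaCPhiLow d iI.mu iI.xiAlphaOneMinusZeroAtZero iI.xiIotaAlphaIAtEi)
    (hI2 : iI.xiAbs + iI.xiIotaAbs < 1) (hI3 : (BetaMap.nobleBetaOfInputs d iI).βΨ < 1)
    (hI4 : 0 ≤ (BetaMap.nobleBetaOfInputs d iI).αFlow)
    (hWFO : NobleInputsWF d iO)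
    (hO1 : 0 ≤ BetaMap.betaCPhiLow d iO.mu iO.xiAlphaOneMinusZeroAtZero iO.xiIotaAlphaIAtEi)
    (hO2 : iO.xiAbs + iO.xiIotaAbs < 1) (hO3 : (BetaMap.nobleBetaOfInputs d iO).βΨ < 1)
    (hO4 : 0 ≤ (BetaMap.nobleBetaOfInputs d iO).αFlow)
    (hI43 : NobleAssumption43At d (nbwThresholdI d)
      (percolationNobleSplit d (nbwThresholdI d) (by omega) (nbwThresholdI_lt_criticalProbI (by omega))) iI)
    (hIW : NobleWeightedDiagramBoundAt d (nbwThresholdI d) bi) (hR : RemValid d CS R)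
    (hS : RemValid d CS R → ∀ (p : unitInterval) (hp : p ∈ Set.Ioo (nbwThresholdI d) (criticalProbI d)),
      (∀ j, Literature.Barriers.CriticalPhenomena.nobleF d cμ c j p ≤ Γ j) →
        NobleAssumption43At d p (percolationNobleSplit d p (by omega) hp.2) iO ∧ NobleWeightedDiagramBoundAt d p bo) :
    TriangleCondition d ∧ PercolationContinuity d ∧ BetaEqOneBoundedRatio d :=
  meanField_of_certificateRem hd hN
    (nobleInitialInputsAt_of_assumption43 (by omega) hWFI hI1 hI2 hI3 hI4 hI43 hIW) hR
    (nobleImprovementInputsRemAt_of_assumption43 (by omega) hWFO hO1 hO2 hO3 hO4 hS)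

/-- **Mean-field behaviour at `d ≥ 7` over the extension `(nobleTriple d, t)` (`Fin 7`), improvement oracle re-cut at cut-off
`CS` with constants `R`, App. D in the kernel — record-shaped providers reused.**  Hypotheses: a certificate over `Fin 7`
for `β^corr(iI)`, `β^corr(iO)`, `bi`, `bo`; the records' well-formedness and (N1′)–(N4); at `p_I`: Assumption 4.3 with
`iI`, the six record cells `bi ∘ castSucc` and the added cell; `RemValid d CS R`; and, under it, on `(p_I, p_c)`: Assumption
4.3 with `iO` and the six record cells `bo ∘ castSucc` under the RECORD's `f ≤ Γ` (exactly the `hS` of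
`meanField_of_certificate_assumption43`, restricted constants), plus the added cell under the extension's `f ≤ Γ`.
Conclusion: triangle condition, `θ(p_c) = 0`, `β = 1` in dimension `d`.  (The un-cut `Fin 7` reading is
`meanField_of_certificateOf_assumption43` with `nobleInitialInputsOf_snoc_of_assumption43` /
`nobleImprovementInputsOf_snoc_of_assumption43`.)
[cite: FitznerVanDerHofstad2016NoBLE, Thm 2.10, Prop. 2.11, Def. 2.9; (2.7) and §2.1; §5.3.2 (first display) p. 1097; §5.3.3; Prop. 4.5(ii); App. D]
[cite: FitznerVanDerHofstad2017, Thm 1.1 and Cor. 1.3; §4.2 (4.18); Prop. 2.2 and (2.21)–(2.23)] -/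
theorem meanField_of_certificateRemOf_snoc_assumption43 (hd : 7 ≤ d) {t : ℕ × ℕ × Set (Site d)} {CS : ℕ}
    {cμ : ℝ} {c : Fin 7 → ℝ} {γ Γ : Fin 3 → ℝ} {R : RemRead → ℝ} {iI iO : BetaMap.Inputs} {bi bo : Fin 7 → ℝ}
    (hN : NobleNumericCertificateOf d cμ c γ Γ (BetaMap.nobleBetaOfInputsCorr d iI)
      (BetaMap.nobleBetaOfInputsCorr d iO) bi bo)
    (hWFI : NobleInputsWF d iI)
    (hI1 : 0 ≤ BetaMap.betaCPhiLow d iI.mu iI.xiAlphaOneMinusZeroAtZero iI.xiIotaAlphaIAtEi)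
    (hI2 : iI.xiAbs + iI.xiIotaAbs < 1) (hI3 : (BetaMap.nobleBetaOfInputs d iI).βΨ < 1)
    (hI4 : 0 ≤ (BetaMap.nobleBetaOfInputs d iI).αFlow)
    (hWFO : NobleInputsWF d iO)
    (hO1 : 0 ≤ BetaMap.betaCPhiLow d iO.mu iO.xiAlphaOneMinusZeroAtZero iO.xiIotaAlphaIAtEi)
    (hO2 : iO.xiAbs + iO.xiIotaAbs < 1) (hO3 : (BetaMap.nobleBetaOfInputs d iO).βΨ < 1)
    (hO4 : 0 ≤ (BetaMap.nobleBetaOfInputs d iO).αFlow)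
    (hI43 : NobleAssumption43At d (nbwThresholdI d)
      (percolationNobleSplit d (nbwThresholdI d) (by omega) (nbwThresholdI_lt_criticalProbI (by omega))) iI)
    (hIW₆ : NobleWeightedDiagramBoundAt d (nbwThresholdI d) (bi ∘ Fin.castSucc))
    (hIW₇ : nobleSupH d t.1 t.2.1 t.2.2 (nbwThresholdI d) ≤ bi (Fin.last 6)) (hR : RemValid d CS R)
    (hS₆ : RemValid d CS R → ∀ (p : unitInterval) (hp : p ∈ Set.Ioo (nbwThresholdI d) (criticalProbI d)),
      (∀ j, Literature.Barriers.CriticalPhenomena.nobleF d cμ (c ∘ Fin.castSucc) j p ≤ Γ j) →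
        NobleAssumption43At d p (percolationNobleSplit d p (by omega) hp.2) iO ∧
          NobleWeightedDiagramBoundAt d p (bo ∘ Fin.castSucc))
    (hS₇ : RemValid d CS R → ∀ (p : unitInterval) (_hp : p ∈ Set.Ioo (nbwThresholdI d) (criticalProbI d)),
      (∀ j, nobleFOf (nobleTripleSnoc d t) cμ c j p ≤ Γ j) → nobleSupH d t.1 t.2.1 t.2.2 p ≤ bo (Fin.last 6)) :
    TriangleCondition d ∧ PercolationContinuity d ∧ BetaEqOneBoundedRatio d :=
  meanField_of_certificateRemOf hd hN
    (nobleInitialInputsOf_snoc_of_assumption43 (by omega) hWFI hI1 hI2 hI3 hI4 hI43 hIW₆ hIW₇) hR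
    (nobleImprovementInputsRemOf_snoc_of_assumption43 (by omega) hWFO hO1 hO2 hO3 hO4 hS₆ hS₇)

end Literature.Probability.FitznerVanDerHofstad2017

end
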